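import Summits.CriticalPhenomena.Ising3DConformalLimit.Theorems.LightConeRoundness.Negative.FalseWithoutMirrors
import HarnessLib

/-!
# The round kernel `1/|x|` on `ℝ³` has a unit-cone Källén–Lehmann representation in the axis frame
(`RoundKernelAxisConeKL (1/2)`), hence `lightConeRoundness_false_without_mirrors` UNCONDITIONALLY

Standing crux disprover of `UnitLightCone.LightConeRoundness` (stmt-CriticalPhenomena-17169), cycle 1, part III.
Discharges the hypothesis of `Negative/FalseWithoutMirrors.lean` at `Δ₀ = 1/2`:

  `(a² + b² + t²)^(-1/2) = ∫ cos(k₀ a + k₁ b) e^{-ω |t|} dμ(k, ω)`,  `μ {ω < ‖k‖} = 0`,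

with the explicit cone-carried measure `μ` = push-forward of `(2π)⁻¹ dθ|_(0,2π] ⊗ dκ|_(0,∞)` under
`(θ, κ) ↦ (k, ω) = (κ (cos θ, sin θ), κ)` (so `ω = ‖k‖`: the massless one-particle shell).  Elementary proof
(no Bessel functions): Fubini, the Laplace–cosine integral `∫₀^∞ e^{-κτ} cos(κ s) dκ = τ/(τ²+s²)` (real part of
`∫₀^∞ e^{(-τ+is)κ} dκ = 1/(τ-is)`), and `∫₀^{2π} τ dθ/(τ² + (a cos θ + b sin θ)²) = 2π/√(a²+b²+τ²)` by an explicit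
GLOBAL antiderivative `E⁻¹ (θ - arctan (c u(θ)/(1 + c v(θ))))`, `E = √(a²+b²+τ²)`, `c = (E-τ)/(E+τ)`,
`(u, v)(θ) = (sin 2θ · P - cos 2θ · Q, cos 2θ · P + sin 2θ · Q)/(a²+b²)`, `P = a²-b²`, `Q = 2ab`.
Consequences: `roundKernelAxisConeKL_half`, and the unconditional negative lemma
`lightConeRoundness_false_without_mirrors : ¬ LightConeRoundnessWithoutMirrors` — window `1/2 ≤ Δ ≤ 1`,
continuity, positivity, homogeneity and BOTH unit light cones do not force a round two-point kernel without the
lattice mirror symmetries.  It also certifies that the Källén–Lehmann hypotheses of the crux / of the support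
`TwoPointLightConeRigidity` (stmt-17170) are satisfiable by a genuine kernel (`K = 1/|x|`, `Δ = 1/2`).
-/

namespace Summit.CriticalPhenomena.Ising3DConformalLimit.Theorems.LightConeRoundness.Negative

open Literature.Probability.LatticeModels MeasureTheory Set Real

/-! ### Lemma A: the Laplace–cosine integral -/

/-- `∫₀^∞ e^{-κτ} cos(κ s) dκ = τ/(τ² + s²)` for `τ > 0` (real part of `∫₀^∞ e^{(-τ+is)κ} dκ = -1/(-τ+is)`). -/
theorem integral_exp_neg_mul_cos {τ : ℝ} (hτ : 0 < τ) (s : ℝ) :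
    ∫ κ in Ioi (0:ℝ), Real.exp (-(κ * τ)) * Real.cos (κ * s) = τ / (τ ^ 2 + s ^ 2) := by
  have hre : (-(τ : ℂ) + (s : ℂ) * Complex.I).re < 0 := by simp [hτ]
  have hint := integrableOn_exp_mul_complex_Ioi hre 0
  have hpt : ∀ κ : ℝ, Real.exp (-(κ * τ)) * Real.cos (κ * s) =
      RCLike.re (Complex.exp ((-(τ : ℂ) + (s : ℂ) * Complex.I) * (κ : ℂ))) := by
    intro κ
    rw [RCLike.re_to_complex, Complex.exp_re]
    congr 2
    · simp; ring
    · simp; ring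
  simp_rw [hpt]
  rw [integral_re hint, integral_exp_mul_complex_Ioi hre 0]
  have hns : Complex.normSq (-(τ : ℂ) + (s : ℂ) * Complex.I) = τ ^ 2 + s ^ 2 := by
    simp [Complex.normSq_apply]; ring
  have hne : τ ^ 2 + s ^ 2 ≠ 0 := by positivity
  simp only [Complex.ofReal_zero, mul_zero, Complex.exp_zero, RCLike.re_to_complex, Complex.div_re,
    Complex.neg_re, Complex.one_re, Complex.neg_im, Complex.one_im, hns]
  simp

/-! ### Lemma B: the angular integral by a global antiderivative -/

/-- Step 1 (derivative of the `arctan` term): with `u² + v² = 1`, `u' = 2v`, `v' = -2u`,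
`1 - (arctan (c u/(1 + c v)))' = (1 - c²)/(1 + 2 c v + c²)`. -/
theorem arctan_step (c u v : ℝ) (huv : u ^ 2 + v ^ 2 = 1) (hden : 1 + c * v ≠ 0)
    (hden2 : 1 + 2 * c * v + c ^ 2 ≠ 0) :
    1 - 1 / (1 + (c * u / (1 + c * v)) ^ 2) *
        ((c * (2 * v) * (1 + c * v) - c * u * (c * -(2 * u))) / (1 + c * v) ^ 2)
      = (1 - c ^ 2) / (1 + 2 * c * v + c ^ 2) := by
  have h1 : c * (2 * v) * (1 + c * v) - c * u * (c * -(2 * u)) = 2 * c * (v + c) := by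
    linear_combination (2 * c ^ 2) * huv
  have h2 : 1 + (c * u / (1 + c * v)) ^ 2 = (1 + 2 * c * v + c ^ 2) / (1 + c * v) ^ 2 := by
    field_simp
    linear_combination (c ^ 2) * huv
  rw [h1, h2]
  field_simp
  ring

/-- Step 2 (the constant `c = (E-τ)/(E+τ)`): `E⁻¹ (1-c²)/(1+2cv+c²) = τ/(τ² + (E²-τ²)(1+v)/2)`. -/
theorem c_step (E τ v : ℝ) (hE : 0 < E) (hτ : 0 < τ) (hD : E ^ 2 + τ ^ 2 + (E ^ 2 - τ ^ 2) * v ≠ 0) :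
    E⁻¹ * ((1 - ((E - τ) / (E + τ)) ^ 2) / (1 + 2 * ((E - τ) / (E + τ)) * v + ((E - τ) / (E + τ)) ^ 2))
      = τ / (τ ^ 2 + (E ^ 2 - τ ^ 2) * (1 + v) / 2) := by
  have hEτ : E + τ ≠ 0 := by positivity
  have hE0 : E ≠ 0 := hE.ne'
  have h1c : 1 - ((E - τ) / (E + τ)) ^ 2 = 4 * E * τ / (E + τ) ^ 2 := by field_simp; ring
  have h2c : 1 + 2 * ((E - τ) / (E + τ)) * v + ((E - τ) / (E + τ)) ^ 2 =
      2 * (E ^ 2 + τ ^ 2 + (E ^ 2 - τ ^ 2) * v) / (E + τ) ^ 2 := by field_simp; ring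
  have h3 : τ ^ 2 + (E ^ 2 - τ ^ 2) * (1 + v) / 2 = (E ^ 2 + τ ^ 2 + (E ^ 2 - τ ^ 2) * v) / 2 := by ring
  rw [h1c, h2c, h3]
  field_simp
  ring

/-- Step 3 (trigonometry): `(a cos θ + b sin θ)² = (a² + b² + cos 2θ (a²-b²) + sin 2θ (2ab))/2`. -/
theorem sq_lin_comb (a b θ : ℝ) :
    (a * Real.cos θ + b * Real.sin θ) ^ 2 =
      (a ^ 2 + b ^ 2 + Real.cos (2 * θ) * (a ^ 2 - b ^ 2) + Real.sin (2 * θ) * (2 * a * b)) / 2 := by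
  rw [Real.cos_two_mul, Real.sin_two_mul]
  linear_combination b ^ 2 * Real.sin_sq_add_cos_sq θ

/-- The rotating frame, first component: `u(θ) = (sin 2θ · P - cos 2θ · Q)/ρ²`. -/
noncomputable def rotU (P Q ρ2 θ : ℝ) : ℝ := (Real.sin (2 * θ) * P - Real.cos (2 * θ) * Q) / ρ2

/-- The rotating frame, second component: `v(θ) = (cos 2θ · P + sin 2θ · Q)/ρ²`. -/
noncomputable def rotV (P Q ρ2 θ : ℝ) : ℝ := (Real.cos (2 * θ) * P + Real.sin (2 * θ) * Q) / ρ2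

/-- `u² + v² = 1` when `P² + Q² = ρ2² ≠ 0`. -/
theorem rotU_sq_add_rotV_sq {P Q ρ2 : ℝ} (hPQ : P ^ 2 + Q ^ 2 = ρ2 ^ 2) (hρ : ρ2 ≠ 0) (θ : ℝ) :
    rotU P Q ρ2 θ ^ 2 + rotV P Q ρ2 θ ^ 2 = 1 := by
  have h1 := Real.sin_sq_add_cos_sq (2 * θ)
  have key : (Real.sin (2 * θ) * P - Real.cos (2 * θ) * Q) ^ 2 +
      (Real.cos (2 * θ) * P + Real.sin (2 * θ) * Q) ^ 2 = ρ2 ^ 2 := by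
    calc _ = (Real.sin (2 * θ) ^ 2 + Real.cos (2 * θ) ^ 2) * (P ^ 2 + Q ^ 2) := by ring
      _ = ρ2 ^ 2 := by rw [h1, hPQ, one_mul]
  rw [rotU, rotV, div_pow, div_pow, ← add_div, key, div_self (pow_ne_zero 2 hρ)]

/-- `u' = 2v`. -/
theorem hasDerivAt_rotU (P Q ρ2 θ : ℝ) : HasDerivAt (rotU P Q ρ2) (2 * rotV P Q ρ2 θ) θ := by
  have h : HasDerivAt (rotU P Q ρ2)
      ((Real.cos (2 * θ) * (2 * 1) * P - -Real.sin (2 * θ) * (2 * 1) * Q) / ρ2) θ :=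
    ((((hasDerivAt_id θ).const_mul 2).sin.mul_const P).fun_sub
      (((hasDerivAt_id θ).const_mul 2).cos.mul_const Q)).div_const ρ2
  refine h.congr_deriv ?_
  rw [rotV]
  ring

/-- `v' = -2u`. -/
theorem hasDerivAt_rotV (P Q ρ2 θ : ℝ) : HasDerivAt (rotV P Q ρ2) (-(2 * rotU P Q ρ2 θ)) θ := by
  have h : HasDerivAt (rotV P Q ρ2)
      ((-Real.sin (2 * θ) * (2 * 1) * P + Real.cos (2 * θ) * (2 * 1) * Q) / ρ2) θ :=
    ((((hasDerivAt_id θ).const_mul 2).cos.mul_const P).fun_add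
      (((hasDerivAt_id θ).const_mul 2).sin.mul_const Q)).div_const ρ2
  refine h.congr_deriv ?_
  rw [rotU]
  ring

/-- The frame is `π`-periodic; in particular it takes the same values at `0` and `2π`. -/
theorem rotU_two_pi (P Q ρ2 : ℝ) : rotU P Q ρ2 (2 * π) = rotU P Q ρ2 0 := by
  simp only [rotU, Real.sin_two_mul, Real.cos_two_mul, mul_zero, Real.sin_zero, Real.cos_zero]
  norm_num

/-- The frame is `π`-periodic; in particular it takes the same values at `0` and `2π`. -/
theorem rotV_two_pi (P Q ρ2 : ℝ) : rotV P Q ρ2 (2 * π) = rotV P Q ρ2 0 := by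
  simp only [rotV, Real.sin_two_mul, Real.cos_two_mul, mul_zero, Real.sin_zero, Real.cos_zero]
  norm_num

/-- The global antiderivative `G(θ) = E⁻¹ (θ - arctan (c u(θ)/(1 + c v(θ))))`. -/
noncomputable def antiderivG (E c P Q ρ2 θ : ℝ) : ℝ :=
  E⁻¹ * (θ - Real.arctan (c * rotU P Q ρ2 θ / (1 + c * rotV P Q ρ2 θ)))

/-- The derivative of the global antiderivative, in closed form `E⁻¹ (1-c²)/(1 + 2c v(θ) + c²)`. -/
theorem hasDerivAt_antiderivG {E c P Q ρ2 : ℝ} (hPQ : P ^ 2 + Q ^ 2 = ρ2 ^ 2) (hρ : ρ2 ≠ 0) (θ : ℝ)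
    (hden : 1 + c * rotV P Q ρ2 θ ≠ 0) (hden2 : 1 + 2 * c * rotV P Q ρ2 θ + c ^ 2 ≠ 0) :
    HasDerivAt (antiderivG E c P Q ρ2) (E⁻¹ * ((1 - c ^ 2) / (1 + 2 * c * rotV P Q ρ2 θ + c ^ 2))) θ := by
  have hq : HasDerivAt (fun y => c * rotU P Q ρ2 y / (1 + c * rotV P Q ρ2 y))
      ((c * (2 * rotV P Q ρ2 θ) * (1 + c * rotV P Q ρ2 θ) -
        c * rotU P Q ρ2 θ * (c * -(2 * rotU P Q ρ2 θ))) / (1 + c * rotV P Q ρ2 θ) ^ 2) θ :=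
    ((hasDerivAt_rotU P Q ρ2 θ).const_mul c).fun_div
      (((hasDerivAt_rotV P Q ρ2 θ).const_mul c).const_add 1) hden
  have hG' : HasDerivAt (antiderivG E c P Q ρ2)
      (E⁻¹ * (1 - 1 / (1 + (c * rotU P Q ρ2 θ / (1 + c * rotV P Q ρ2 θ)) ^ 2) *
        ((c * (2 * rotV P Q ρ2 θ) * (1 + c * rotV P Q ρ2 θ) -
          c * rotU P Q ρ2 θ * (c * -(2 * rotU P Q ρ2 θ))) / (1 + c * rotV P Q ρ2 θ) ^ 2))) θ :=
    ((hasDerivAt_id θ).fun_sub hq.arctan).const_mul E⁻¹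
  refine hG'.congr_deriv ?_
  rw [arctan_step c (rotU P Q ρ2 θ) (rotV P Q ρ2 θ) (rotU_sq_add_rotV_sq hPQ hρ θ) hden hden2]

/-- The angular integral: `∫₀^{2π} τ/(τ² + (a cos θ + b sin θ)²) dθ = 2π/√(a²+b²+τ²)` (`τ > 0`). -/
theorem integral_angular {τ : ℝ} (hτ : 0 < τ) (a b : ℝ) :
    ∫ θ in (0:ℝ)..2 * π, τ / (τ ^ 2 + (a * Real.cos θ + b * Real.sin θ) ^ 2) =
      2 * π / Real.sqrt (a ^ 2 + b ^ 2 + τ ^ 2) := by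
  rcases eq_or_ne (a ^ 2 + b ^ 2) 0 with hρ | hρ
  · -- degenerate direction `a = b = 0`: constant integrand
    have ha : a = 0 := by nlinarith [sq_nonneg a, sq_nonneg b]
    have hb : b = 0 := by nlinarith [sq_nonneg a, sq_nonneg b]
    subst ha; subst hb
    simp only [zero_mul, add_zero, ne_eq, OfNat.ofNat_ne_zero, not_false_eq_true, zero_pow, zero_add,
      intervalIntegral.integral_const, sub_zero, smul_eq_mul]
    rw [Real.sqrt_sq hτ.le]
    field_simp
  -- generic direction
  have hρpos : 0 < a ^ 2 + b ^ 2 := lt_of_le_of_ne (by positivity) (Ne.symm hρ)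
  have hPQ : (a ^ 2 - b ^ 2) ^ 2 + (2 * a * b) ^ 2 = (a ^ 2 + b ^ 2) ^ 2 := by ring
  have hE2 : Real.sqrt (a ^ 2 + b ^ 2 + τ ^ 2) ^ 2 = a ^ 2 + b ^ 2 + τ ^ 2 := Real.sq_sqrt (by positivity)
  have hEpos : 0 < Real.sqrt (a ^ 2 + b ^ 2 + τ ^ 2) := Real.sqrt_pos.mpr (by positivity)
  -- abbreviations (plain terms, no local definitions)
  obtain ⟨E, hE⟩ : ∃ E, E = Real.sqrt (a ^ 2 + b ^ 2 + τ ^ 2) := ⟨_, rfl⟩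
  rw [← hE] at hE2 hEpos ⊢
  have hEτ : τ < E := by nlinarith
  obtain ⟨c, hc⟩ : ∃ c, c = (E - τ) / (E + τ) := ⟨_, rfl⟩
  have hc0 : 0 ≤ c := by rw [hc]; exact div_nonneg (by linarith) (by linarith)
  have hc1 : c < 1 := by rw [hc, div_lt_one (by linarith)]; linarith
  have huv := rotU_sq_add_rotV_sq hPQ hρ
  have hv1 : ∀ θ, -1 ≤ rotV (a ^ 2 - b ^ 2) (2 * a * b) (a ^ 2 + b ^ 2) θ := fun θ => by
    nlinarith [huv θ, sq_nonneg (rotU (a ^ 2 - b ^ 2) (2 * a * b) (a ^ 2 + b ^ 2) θ),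
      sq_nonneg (rotV (a ^ 2 - b ^ 2) (2 * a * b) (a ^ 2 + b ^ 2) θ + 1)]
  have hden : ∀ θ, 0 < 1 + c * rotV (a ^ 2 - b ^ 2) (2 * a * b) (a ^ 2 + b ^ 2) θ := fun θ => by
    nlinarith [hv1 θ, hc0, hc1]
  have hden2 : ∀ θ, 0 < 1 + 2 * c * rotV (a ^ 2 - b ^ 2) (2 * a * b) (a ^ 2 + b ^ 2) θ + c ^ 2 :=
    fun θ => by nlinarith [hv1 θ, hc0, hc1]
  -- s(θ)² in the rotating frame
  have hsE : ∀ θ, (a * Real.cos θ + b * Real.sin θ) ^ 2 =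
      (E ^ 2 - τ ^ 2) * (1 + rotV (a ^ 2 - b ^ 2) (2 * a * b) (a ^ 2 + b ^ 2) θ) / 2 := by
    intro θ
    rw [sq_lin_comb, hE2, rotV]
    field_simp
    ring
  -- the global antiderivative has the integrand as derivative
  have hderiv : ∀ θ, HasDerivAt (antiderivG E c (a ^ 2 - b ^ 2) (2 * a * b) (a ^ 2 + b ^ 2))
      (τ / (τ ^ 2 + (a * Real.cos θ + b * Real.sin θ) ^ 2)) θ := by
    intro θ
    have h := hasDerivAt_antiderivG (E := E) (c := c) hPQ hρ θ (hden θ).ne' (hden2 θ).ne'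
    refine h.congr_deriv ?_
    have hD : E ^ 2 + τ ^ 2 + (E ^ 2 - τ ^ 2) * rotV (a ^ 2 - b ^ 2) (2 * a * b) (a ^ 2 + b ^ 2) θ ≠ 0 := by
      have h2 : E ^ 2 + τ ^ 2 + (E ^ 2 - τ ^ 2) * rotV (a ^ 2 - b ^ 2) (2 * a * b) (a ^ 2 + b ^ 2) θ =
          2 * (τ ^ 2 + (a * Real.cos θ + b * Real.sin θ) ^ 2) := by
        rw [hsE θ]; ring
      rw [h2]; positivity
    rw [hsE θ, hc]
    exact c_step E τ _ hEpos hτ hD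
  have hcont : Continuous fun θ => τ / (τ ^ 2 + (a * Real.cos θ + b * Real.sin θ) ^ 2) := by
    refine continuous_const.div (by fun_prop) fun θ => ?_
    positivity
  rw [intervalIntegral.integral_eq_sub_of_hasDerivAt (fun θ _ => hderiv θ) (hcont.intervalIntegrable _ _)]
  -- evaluate G(2π) - G(0)
  rw [antiderivG, antiderivG, rotU_two_pi, rotV_two_pi]
  field_simp
  ring

/-! ### The cone-carried measure and the representation -/

/-- The unit vector `(cos θ, sin θ)` of the transverse momentum plane. -/
noncomputable def shellDir (θ : ℝ) : EuclideanSpace ℝ (Fin 2) :=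
  Real.cos θ • EuclideanSpace.single 0 (1:ℝ) + Real.sin θ • EuclideanSpace.single 1 (1:ℝ)

/-- First coordinate of the unit vector. -/
@[simp] theorem shellDir_apply_zero (θ : ℝ) : shellDir θ 0 = Real.cos θ := by simp [shellDir]

/-- Second coordinate of the unit vector. -/
@[simp] theorem shellDir_apply_one (θ : ℝ) : shellDir θ 1 = Real.sin θ := by simp [shellDir]

/-- `‖(cos θ, sin θ)‖ = 1`. -/
theorem norm_shellDir (θ : ℝ) : ‖shellDir θ‖ = 1 := by
  rw [EuclideanSpace.norm_eq]
  simp [Fin.sum_univ_two, Real.cos_sq_add_sin_sq]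

/-- `shellDir` is continuous. -/
theorem continuous_shellDir : Continuous shellDir := by
  unfold shellDir
  exact (Real.continuous_cos.smul continuous_const).add (Real.continuous_sin.smul continuous_const)

/-- Polar parametrisation of the massless shell: `(θ, κ) ↦ (k, ω) = (κ (cos θ, sin θ), κ)`. -/
noncomputable def shell (z : ℝ × ℝ) : EuclideanSpace ℝ (Fin 2) × ℝ := (z.2 • shellDir z.1, z.2)

/-- `shell` is continuous. -/
theorem continuous_shell : Continuous shell :=
  (continuous_snd.smul (continuous_shellDir.comp continuous_fst)).prodMk continuous_snd

/-- The polar base measure `(2π)⁻¹ dθ|_(0,2π] ⊗ dκ|_(0,∞)`. -/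
noncomputable def polarBase : Measure (ℝ × ℝ) :=
  ENNReal.ofReal (1 / (2 * π)) • (volume.restrict (Ioc 0 (2 * π))).prod (volume.restrict (Ioi (0:ℝ)))

/-- The Källén–Lehmann measure of `1/|x|` in the axis frame: the massless shell `ω = ‖k‖` with density
`d²k/(2π‖k‖) = (2π)⁻¹ dθ dκ`. -/
noncomputable def shellMeasure : Measure (EuclideanSpace ℝ (Fin 2) × ℝ) :=
  Measure.map shell polarBase

/-- The shell measure gives no weight to the spacelike region `{ω < ‖k‖}`. -/
theorem shellMeasure_cone : shellMeasure {p : EuclideanSpace ℝ (Fin 2) × ℝ | p.2 < ‖p.1‖} = 0 := by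
  rw [shellMeasure, Measure.map_apply continuous_shell.measurable measurableSet_spacelike]
  have hsub : shell ⁻¹' {p : EuclideanSpace ℝ (Fin 2) × ℝ | p.2 < ‖p.1‖} ⊆ (univ : Set ℝ) ×ˢ Iio (0:ℝ) := by
    intro z hz
    simp only [shell, mem_preimage, mem_setOf_eq, norm_smul, Real.norm_eq_abs, norm_shellDir, mul_one] at hz
    simp only [mem_prod, mem_univ, mem_Iio, true_and]
    by_contra h
    push Not at h
    rw [abs_of_nonneg h] at hz
    exact lt_irrefl _ hz
  refine measure_mono_null hsub ?_
  rw [polarBase, Measure.smul_apply, Measure.prod_prod, Measure.restrict_apply measurableSet_Iio,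
    Set.Iio_inter_Ioi, Set.Ioo_self, measure_empty, mul_zero, smul_zero]

/-- The Källén–Lehmann integrand on the shell. -/
theorem klIntegrand_shell (a b t : ℝ) (z : ℝ × ℝ) :
    Real.cos ((shell z).1 0 * a + (shell z).1 1 * b) * Real.exp (-((shell z).2 * |t|)) =
      Real.exp (-(z.2 * |t|)) * Real.cos (z.2 * (a * Real.cos z.1 + b * Real.sin z.1)) := by
  simp only [shell, PiLp.smul_apply, smul_eq_mul, shellDir_apply_zero, shellDir_apply_one]
  rw [mul_comm]
  congr 2
  ring

/-- Integrability of the Källén–Lehmann integrand against the polar base (for `t ≠ 0`). -/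
theorem integrable_klIntegrand_shell {t : ℝ} (ht : t ≠ 0) (a b : ℝ) :
    Integrable (fun z : ℝ × ℝ => Real.cos ((shell z).1 0 * a + (shell z).1 1 * b) *
      Real.exp (-((shell z).2 * |t|))) ((volume.restrict (Ioc 0 (2 * π))).prod (volume.restrict (Ioi (0:ℝ)))) := by
  have hτ : 0 < |t| := abs_pos.mpr ht
  have hg : Integrable (fun z : ℝ × ℝ => (1:ℝ) * Real.exp (-|t| * z.2))
      ((volume.restrict (Ioc 0 (2 * π))).prod (volume.restrict (Ioi (0:ℝ)))) :=
    Integrable.mul_prod (integrable_const 1) (exp_neg_integrableOn_Ioi 0 hτ)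
  refine hg.mono' ((continuous_klIntegrand a b t).comp continuous_shell).aestronglyMeasurable
    (Filter.Eventually.of_forall fun z => ?_)
  rw [klIntegrand_shell]
  rw [Real.norm_eq_abs, abs_mul, Real.abs_exp, one_mul, show -(z.2 * |t|) = -|t| * z.2 by ring]
  exact mul_le_of_le_one_right (Real.exp_pos _).le (Real.abs_cos_le_one _)

/-- **The round kernel at `Δ = 1/2` has a unit-cone Källén–Lehmann representation in the axis frame**:
`(a² + b² + t²)^(-1/2) = ∫ cos(k₀a + k₁b) e^{-ω|t|} d(shellMeasure)` for `t ≠ 0`. -/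
theorem roundKernelAxisConeKL_half : RoundKernelAxisConeKL (1 / 2) := by
  refine ⟨shellMeasure, shellMeasure_cone, fun t a b ht => ?_⟩
  have hτ : 0 < |t| := abs_pos.mpr ht
  rw [shellMeasure, integral_map continuous_shell.measurable.aemeasurable
    (continuous_klIntegrand a b t).aestronglyMeasurable, polarBase, integral_smul_measure,
    ENNReal.toReal_ofReal (by positivity), integral_prod _ (integrable_klIntegrand_shell ht a b)]
  simp_rw [klIntegrand_shell]
  have hinner : ∀ θ : ℝ, ∫ κ in Ioi (0:ℝ), Real.exp (-(κ * |t|)) *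
      Real.cos (κ * (a * Real.cos θ + b * Real.sin θ)) =
      |t| / (|t| ^ 2 + (a * Real.cos θ + b * Real.sin θ) ^ 2) := fun θ => integral_exp_neg_mul_cos hτ _
  simp_rw [hinner]
  rw [← intervalIntegral.integral_of_le (by positivity), integral_angular hτ a b, sq_abs,
    Real.rpow_neg (by positivity), ← Real.sqrt_eq_rpow, smul_eq_mul]
  field_simp

/-- **Unconditional form of the mirror load-bearing lemma.**  Window `1/2 ≤ Δ ≤ 1`, continuity, positivity,
homogeneity and BOTH unit-cone Källén–Lehmann representations do not force a round two-point kernel without the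
lattice mirror symmetries: `LightConeRoundnessWithoutMirrors` is false (ellipsoid witness at `Δ₀ = 1/2`). -/
theorem lightConeRoundness_false_without_mirrors : ¬ LightConeRoundnessWithoutMirrors :=
  lightConeRoundness_false_without_mirrors_of_roundKL (Δ₀ := 1 / 2) le_rfl (by norm_num)
    roundKernelAxisConeKL_half

end Summit.CriticalPhenomena.Ising3DConformalLimit.Theorems.LightConeRoundness.Negative
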